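import Mathlib
import HarnessLib
import Summits.Ventures.LatticeQCDFlow.Exactness.FlowMCMC
import Summits.Ventures.LatticeQCDFlow.Scaling.ImportanceWeights
import Summits.Ventures.LatticeQCDFlow.Scoring.IMHPositiveCorrelations

/-!
# IMH acceptance and sector occupation from the proposal weights alone (docket L2-A18)

HONEST FRAMING: exact (Metropolis-corrected) sampling algorithms for lattice gauge theory;
figures of merit are autocorrelation/cost numbers at stated couplings and volumes; no
continuum-physics claim.

Venture `LatticeQCDFlow` (cell pub-lqcd), sub-topic `Scoring`; FANOUT row 11 (`eng-scorerA`),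
row 11 GEN-14, 2026-08-21.  NEW WORK of the cell (finite-sum algebra on the tree's `accRate`,
`imhKernel`, `weight`, `symFlow`), not a published result; nothing is cited as a fact.

## Content

The gauge seat's BASELINES AMENDMENT 29 (λ″) offered rows 11/12 two 'IMH exactness-in-practice
reads' of a flow-MCMC chain that stores its per-proposal log-weights (CHAINFORMAT `log_w`):
(i) the **acceptance identity** — the measured Metropolis acceptance should equal
`A = Σ_i ω_i a_i` computed from the iid proposal weights alone (`ω` self-normalised weights,
`a_i` the mean acceptance from state `i`; A29: 0.0466 predicted vs 0.0474 measured on board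
l.77), and (ii) **occupation = weight share** — the time the exact chain spends in a sector
should equal that sector's share of the total importance weight (0.97–0.99 on l.77).  Row 11
docketed them as LEADERBOARD-2-DOCKET-A L2-A18.  This file types the population identities
behind both, on a finite state space with target `p` (normalised), model `q > 0`, importance
weight `w = p/q` (`Theory2.weight`) and UN-normalised weights `W = c·w` (`c > 0` unknown — the
sampler only ever knows `exp(−S)/q`):

* `accRate p q = Σ_x Σ_y q_x q_y min(w_x, w_y)` (`accRate_eq_qq_min_weight`): the stationary
  mean acceptance (tree `Exactness.accRate`, `= 1 − ‖p⊗q − q⊗p‖_TV` by theory-2) is the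
  `q ⊗ q` expectation of the MIN OF TWO INDEPENDENT PROPOSAL WEIGHTS;
* with un-normalised weights, `accRate p q = E_{q⊗q}[min(W, W′)] / E_q[W]`
  (`accRate_eq_unnormalised`) — estimable from iid proposals and their log-weights with NO
  oracle and no knowledge of `Z`, hence in 4-d where K0 has no reference (docket L2-A15);
* gauge's finite-sample formula IS the plug-in of that ratio: for any positive weights
  `W_1..W_n`, `Σ_i (W_i/ΣW)·((1/n)Σ_j min(1, W_j/W_i)) = (Σ_i Σ_j min(W_i, W_j)) / (n·ΣW)`
  (`gaugeEstimator_eq`);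
* what 'acceptance' means for the KERNEL: `accRate p q = 1 − Σ_x p_x P(x,x) + Σ_x p_x q_x`
  (`accRate_eq_one_sub_holding`; the last term is the self-proposal mass, of measure zero for a
  continuous flow) — so (i) compares the chain's accept/reject record with its own declared
  weights;
* occupation = weight share: `Σ_{x∈S} p_x = (Σ_{x∈S} q_x W_x) / (Σ_x q_x W_x)`
  (`occupation_eq_weightShare`), the population version of (ii).

Power statement (row 11's reading for the LB-3 ruling, not typed): (i)/(ii) test the ACCEPT STEP
against the sampler's OWN weights, so they catch X-1-class defects (accept-all, a mis-coded
Metropolis ratio) without an oracle, and are satisfied identically by an X-2-class sampler (wrong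
weights used consistently, e.g. a dropped log-det) — never a substitute for a reference plaquette.
-/

namespace Summit.Ventures.LatticeQCDFlow.Scoring

open Finset Literature.Probability.MarkovChains Summit.Ventures.LatticeQCDFlow.Exactness
  Summit.Ventures.LatticeQCDFlow.Theory2

variable {X : Type*} [Fintype X] [DecidableEq X]

omit [Fintype X] [DecidableEq X] in
/-- Termwise: `min(p_x q_y, p_y q_x) = q_x q_y · min(w_x, w_y)` with `w = p/q`, `q > 0`. -/
theorem min_flow_eq_qq_min_weight {p q : X → ℝ} (hq : ∀ x, 0 < q x) (x y : X) :
    min (p x * q y) (p y * q x) = q x * q y * min (weight p q x) (weight p q y) := by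
  rw [(monotone_mul_left_of_nonneg (mul_pos (hq x) (hq y)).le).map_min]
  have hx : q x ≠ 0 := (hq x).ne'
  have hy : q y ≠ 0 := (hq y).ne'
  have h1 : q x * q y * weight p q x = p x * q y := by unfold weight; field_simp
  have h2 : q x * q y * weight p q y = p y * q x := by unfold weight; field_simp
  rw [h1, h2]

omit [DecidableEq X] in
/-- **Acceptance = `E_{q⊗q}[min(w, w′)]`**: the stationary mean IMH acceptance is the expectation,
over two INDEPENDENT proposals, of the smaller of their importance weights. -/
theorem accRate_eq_qq_min_weight {p q : X → ℝ} (hq : ∀ x, 0 < q x) :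
    accRate p q = ∑ x, ∑ y, q x * q y * min (weight p q x) (weight p q y) := by
  unfold accRate
  exact sum_congr rfl fun x _ => sum_congr rfl fun y _ => min_flow_eq_qq_min_weight hq x y

omit [DecidableEq X] in
/-- **Acceptance from UN-normalised weights** `W = c·w` (`c > 0` unknown to the sampler):
`accRate p q = E_{q⊗q}[min(W, W′)] / E_q[W]` — no partition function, no oracle. -/
theorem accRate_eq_unnormalised {p q : X → ℝ} (hp1 : ∑ x, p x = 1) (hq : ∀ x, 0 < q x)
    {c : ℝ} (hc : 0 < c) :
    accRate p q
      = (∑ x, ∑ y, q x * q y * min (c * weight p q x) (c * weight p q y))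
          / ∑ x, q x * (c * weight p q x) := by
  have hmin : ∀ x y, min (c * weight p q x) (c * weight p q y)
      = c * min (weight p q x) (weight p q y) :=
    fun x y => ((monotone_mul_left_of_nonneg hc.le).map_min).symm
  have hnum : ∑ x, ∑ y, q x * q y * min (c * weight p q x) (c * weight p q y)
      = c * accRate p q := by
    rw [accRate_eq_qq_min_weight hq, mul_sum]
    refine sum_congr rfl fun x _ => ?_
    rw [mul_sum]
    refine sum_congr rfl fun y _ => ?_
    rw [hmin]
    ring
  have hden : ∑ x, q x * (c * weight p q x) = c := by
    have : ∀ x, q x * (c * weight p q x) = c * p x := fun x => by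
      rw [mul_left_comm, mul_weight (hq x).ne']
    simp_rw [this]
    rw [← mul_sum, hp1, mul_one]
  rw [hnum, hden]
  field_simp

/-- **Gauge's A29 estimator is the plug-in of that ratio.**  For any positive weights
`W_1, …, W_n` (the stored un-normalised weights of `n` iid proposals):
`Σ_i (W_i / ΣW) · ((1/n) Σ_j min(1, W_j / W_i)) = (Σ_i Σ_j min(W_i, W_j)) / (n · ΣW)`,
i.e. 'self-normalised weight × mean acceptance from state i' summed over i equals the
V-statistic of `min(W, W′)` over `E[W]`. -/
theorem gaugeEstimator_eq {ι : Type*} [Fintype ι] {W : ι → ℝ} (hW : ∀ i, 0 < W i) :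
    ∑ i, (W i / ∑ j, W j) * ((∑ j, min 1 (W j / W i)) / Fintype.card ι)
      = (∑ i, ∑ j, min (W i) (W j)) / (Fintype.card ι * ∑ j, W j) := by
  have key : ∀ i j, W i * min 1 (W j / W i) = min (W i) (W j) := by
    intro i j
    rw [(monotone_mul_left_of_nonneg (hW i).le).map_min, mul_one]
    congr 1
    have : W i ≠ 0 := (hW i).ne'
    field_simp
  calc ∑ i, (W i / ∑ j, W j) * ((∑ j, min 1 (W j / W i)) / Fintype.card ι)
      = ∑ i, (W i * ∑ j, min 1 (W j / W i)) / ((∑ j, W j) * Fintype.card ι) :=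
        sum_congr rfl fun i _ => by rw [div_mul_div_comm]
    _ = (∑ i, W i * ∑ j, min 1 (W j / W i)) / ((∑ j, W j) * Fintype.card ι) := by
        rw [sum_div]
    _ = (∑ i, ∑ j, min (W i) (W j)) / (Fintype.card ι * ∑ j, W j) := by
        congr 1
        · exact sum_congr rfl fun i _ => by
            rw [mul_sum]
            exact sum_congr rfl fun j _ => key i j
        · exact mul_comm _ _

/-- **What the kernel's acceptance is**: `accRate p q = 1 − Σ_x p_x P(x,x) + Σ_x p_x q_x` — one
minus the stationary holding mass plus the self-proposal mass (a proposal equal to the current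
state is 'accepted'; of measure zero for a continuous flow).  So identity (i) compares the
chain's accept/reject record with its own declared weights. -/
theorem accRate_eq_one_sub_holding {p q : X → ℝ} (hp : ∀ x, 0 < p x) (hp1 : ∑ x, p x = 1) :
    accRate p q = 1 - ∑ x, p x * imhKernel p q x x + ∑ x, p x * q x := by
  unfold accRate
  have h : ∀ x, ∑ z, min (p x * q z) (p z * q x)
      = (p x - p x * imhKernel p q x x) + p x * q x := by
    intro x
    rw [← sum_erase_add _ _ (mem_univ x), min_self, mul_imhKernel_self hp x]
    unfold symFlow
    ring
  rw [sum_congr rfl fun x _ => h x, sum_add_distrib, sum_sub_distrib, hp1]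

omit [DecidableEq X] in
/-- **Occupation = weight share** (A29 (ii), population version): the stationary probability of
a set of states (a topological sector) equals that set's share of the total importance weight
of the proposal law, for any un-normalised `W = c·w`. -/
theorem occupation_eq_weightShare {p q : X → ℝ} (hp1 : ∑ x, p x = 1) (hq : ∀ x, 0 < q x)
    {c : ℝ} (hc : 0 < c) (S : Finset X) :
    ∑ x ∈ S, p x = (∑ x ∈ S, q x * (c * weight p q x)) / ∑ x, q x * (c * weight p q x) := by
  have hterm : ∀ x, q x * (c * weight p q x) = c * p x := fun x => by
    rw [mul_left_comm, mul_weight (hq x).ne']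
  simp_rw [hterm]
  rw [← mul_sum, ← mul_sum, hp1, mul_one]
  field_simp

end Summit.Ventures.LatticeQCDFlow.Scoring
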